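import Summits.QuantumFields.YangMills.Theorems.ColdStartUniversalityLatticeLangevinLiebRobinsonPlaquetteCovarianceSum
import Literature.Barriers.QuantumFields.ToronPlaneAnticorrelationProof
import HarnessLib

/-!
# Route `ColdStartUniversality` (fixed-cut-off SZZ dynamics; LIEB–ROBINSON / LOCALITY package, file 20):
# ★★★ THE COUPLING DERIVATIVE OF WILSON LOOP EXPECTATIONS IS BOUNDED UNIFORMLY IN THE VOLUME at `|β'| < 1/12`

Helper file (seat `ym-line-csu-p1`, g31; `--supports stmt-QuantumFields-24809`).  For the `SU(2)` Wilson measures `μ_b` on `(ℤ/L)³`: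
* ★★★ `wilson_loop_action_covariance_abs_le` — `|Cov_(μ_β')(Re tr w, S_W)| ≤ 3|w|(1024π²|w|²/ρ)e^κ(1+12/κ)³/(1−e^(−κ/2))` at `|β'| < 1/12`, every `L`,
  although the Wilson action `S_W = Σ_p (2 − Re tr U_p)` has `3L³` terms (file 19);
* `wilsonMeasure_eq_tilted_wilsonMeasure_su2` — `μ_b = μ_(β')` tilted by `(b − β')·(−S_W)` (exponential family);
* ★★ `hasDerivAt_wilson_loop_expectation` — EVERY coupling, every `L`: `d/db ⟨Re tr w⟩_(μ_b) |_(b=β') = −Cov_(μ_β')(Re tr w, S_W)`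
  (first cumulant of a Gibbs tilt, `ToronCumulant.hasDerivAt_integral_tilted_zero`);
* ★★★ `wilson_action_variance_le` — `Var_(μ_β')(S_W) ≤ #𝒫·12(16384π²/ρ)e^κ(1+12/κ)³/(1−e^(−κ/2))`: the specific heat per plaquette
  `Var(S_W)/#𝒫` is bounded INDEPENDENTLY OF THE VOLUME at `|β'| < 1/12`;
* ★★★ `abs_deriv_wilson_loop_expectation_le` — `|d/db ⟨Re tr w⟩_(μ_b)|_(b=β')| ≤ 3|w|(1024π²|w|²/ρ)e^κ(1+12/κ)³/(1−e^(−κ/2))` for `|β'| < 1/12`: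
  Wilson loop expectations respond to the coupling at a VOLUME-INDEPENDENT rate in the strong-coupling window — exponential clustering at work.
THEOREMS ONLY, no definition, no sorry; [folklore] / [cite: Wilson1974, §III].  HONEST FRAMING: fixed cut-off, FIXED strong-coupling window; smoothness in
the coupling here says nothing about the weak-coupling / continuum regime of the route (`β'_K → ∞`); `UniformColdStartMixing` (24809) is NOT restated;
no crux, rung or summit statement is proved; the Yang–Mills mass gap is NOT proved.
-/

set_option autoImplicit false

noncomputable section

namespace Summit.QuantumFields.YangMills.Theorems.ColdStartUniversality.LiebRobinson

open MeasureTheory ProbabilityTheory Matrix Complex Finset Filter Set Metric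
open scoped ComplexConjugate BigOperators Matrix NNReal ENNReal Topology
open Literature.Probability.Process Literature.MathematicalPhysics.QuantumFieldTheory
open Literature.MathematicalPhysics.QuantumFieldTheory.Balaban1983to89
open Literature.MathematicalPhysics.QuantumLattice (fundamentalRep fundamentalLatticeRep continuous_fundamentalRep fundamentalRep_apply)

variable {L : ℕ} [NeZero L]

/-! ## §1. The covariance with the Wilson action -/

/-- ★★★ **The covariance of a Wilson loop with the TOTAL ACTION is bounded uniformly in the volume** (`|β'| < 1/12`):
`|Cov_(μ_β')(Re tr w, S_W)| ≤ 3|w|·(1024π²|w|²/ρ)·e^κ·(1+12/κ)³/(1 − e^(−κ/2))`, `S_W = Σ_p (2 − Re tr U_p)` the Wilson action of the `SU(2)` theory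
on `(ℤ/L)³` — although `S_W` is a sum of `3L³` terms (`wilsonAction_eq_sum_word` + `sum_plaquette_covariance_abs_le`). [folklore] -/
theorem wilson_loop_action_covariance_abs_le (L : ℕ) [NeZero L] (β' : ℝ) (hβ : |β'| < 1 / 12) (l₁ : List (Edge 3 L × Bool)) (hl₁ : l₁ ≠ []) :
    let coords : GaugeConfig 3 L (Matrix.specialUnitaryGroup (Fin 2) ℂ) → (Edge 3 L × Fin 2 × Fin 2 × Bool → ℝ) :=
      fun V q => (fun z : ℂ => if q.2.2.2 then z.im else z.re)
        ((fundamentalRep (Fin 2) (V q.1) : Matrix (Fin 2) (Fin 2) ℂ) q.2.1 q.2.2.1)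
    |(∫ x, (fun y : (Edge 3 L × Fin 2 × Fin 2 × Bool → ℝ) => ((l₁.map (fun a : Edge 3 L × Bool => if a.2 then ((fun (ee : Edge 3 L) => Matrix.of fun (i j : Fin 2) => ((y (ee, i, j, false) : ℝ) : ℂ) + ((y (ee, i, j, true) : ℝ) : ℂ) * Complex.I) a.1)ᴴ else (fun (ee : Edge 3 L) => Matrix.of fun (i j : Fin 2) => ((y (ee, i, j, false) : ℝ) : ℂ) + ((y (ee, i, j, true) : ℝ) : ℂ) * Complex.I) a.1)).prod).trace.re) (coords x) * Literature.MathematicalPhysics.QuantumFieldTheory.wilsonAction (fundamentalRep (Fin 2)) x ∂(wilsonMeasure (d := 3) (L := L) (fundamentalRep (Fin 2)) β')) -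
        (∫ x, (fun y : (Edge 3 L × Fin 2 × Fin 2 × Bool → ℝ) => ((l₁.map (fun a : Edge 3 L × Bool => if a.2 then ((fun (ee : Edge 3 L) => Matrix.of fun (i j : Fin 2) => ((y (ee, i, j, false) : ℝ) : ℂ) + ((y (ee, i, j, true) : ℝ) : ℂ) * Complex.I) a.1)ᴴ else (fun (ee : Edge 3 L) => Matrix.of fun (i j : Fin 2) => ((y (ee, i, j, false) : ℝ) : ℂ) + ((y (ee, i, j, true) : ℝ) : ℂ) * Complex.I) a.1)).prod).trace.re) (coords x) ∂(wilsonMeasure (d := 3) (L := L) (fundamentalRep (Fin 2)) β')) * (∫ x, Literature.MathematicalPhysics.QuantumFieldTheory.wilsonAction (fundamentalRep (Fin 2)) x ∂(wilsonMeasure (d := 3) (L := L) (fundamentalRep (Fin 2)) β'))| ≤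
      3 * (l₁.length : ℝ) * ((1024 * Real.pi ^ 2 * (l₁.length : ℝ) ^ 2 / (1 - 12 * |β'|)) * Real.exp ((1 - 12 * |β'|) * Real.log 108 / (2 * ((1300 + 4 * Real.sqrt 2) * |β'| + (1 - 12 * |β'|))))) * ((1 + 12 / ((1 - 12 * |β'|) * Real.log 108 / (2 * ((1300 + 4 * Real.sqrt 2) * |β'| + (1 - 12 * |β'|))))) ^ 3 / (1 - Real.exp (-(((1 - 12 * |β'|) * Real.log 108 / (2 * ((1300 + 4 * Real.sqrt 2) * |β'| + (1 - 12 * |β'|)))) / 2)))) := by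
  intro coords
  classical
  haveI := secondCountableTopology_su2
  haveI := borelSpace_config L
  set μ : Measure (GaugeConfig 3 L (Matrix.specialUnitaryGroup (Fin 2) ℂ)) := (wilsonMeasure (d := 3) (L := L) (fundamentalRep (Fin 2)) β') with hμ
  haveI : IsProbabilityMeasure μ :=
    isProbabilityMeasure_wilsonMeasure (d := 3) (L := L) (fundamentalRep (Fin 2)) (continuous_fundamentalRep (Fin 2)) β'
  have hco : Continuous coords := continuous_coords (L := L)
  have hWc : Continuous fun x => (fun y : (Edge 3 L × Fin 2 × Fin 2 × Bool → ℝ) => ((l₁.map (fun a : Edge 3 L × Bool => if a.2 then ((fun (ee : Edge 3 L) => Matrix.of fun (i j : Fin 2) => ((y (ee, i, j, false) : ℝ) : ℂ) + ((y (ee, i, j, true) : ℝ) : ℂ) * Complex.I) a.1)ᴴ else (fun (ee : Edge 3 L) => Matrix.of fun (i j : Fin 2) => ((y (ee, i, j, false) : ℝ) : ℂ) + ((y (ee, i, j, true) : ℝ) : ℂ) * Complex.I) a.1)).prod).trace.re) (coords x) := (contDiff_word (L := L) l₁ (m := 1)).continuous.comp hco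
  have hPc : ∀ p : Plaquette 3 L, Continuous fun x => (fun y : (Edge 3 L × Fin 2 × Fin 2 × Bool → ℝ) => (([((p.1, p.2.1.1), false), ((Literature.MathematicalPhysics.QuantumFieldTheory.Site.shift p.1 p.2.1.1, p.2.1.2), false), ((Literature.MathematicalPhysics.QuantumFieldTheory.Site.shift p.1 p.2.1.2, p.2.1.1), true), ((p.1, p.2.1.2), true)].map (fun a : Edge 3 L × Bool => if a.2 then ((fun (ee : Edge 3 L) => Matrix.of fun (i j : Fin 2) => ((y (ee, i, j, false) : ℝ) : ℂ) + ((y (ee, i, j, true) : ℝ) : ℂ) * Complex.I) a.1)ᴴ else (fun (ee : Edge 3 L) => Matrix.of fun (i j : Fin 2) => ((y (ee, i, j, false) : ℝ) : ℂ) + ((y (ee, i, j, true) : ℝ) : ℂ) * Complex.I) a.1)).prod).trace.re) (coords x) := fun p =>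
    (contDiff_word (L := L) [((p.1, p.2.1.1), false), ((Literature.MathematicalPhysics.QuantumFieldTheory.Site.shift p.1 p.2.1.1, p.2.1.2), false), ((Literature.MathematicalPhysics.QuantumFieldTheory.Site.shift p.1 p.2.1.2, p.2.1.1), true), ((p.1, p.2.1.2), true)] (m := 1)).continuous.comp hco
  -- expand the action through words
  have hS : ∀ x : GaugeConfig 3 L (Matrix.specialUnitaryGroup (Fin 2) ℂ),
      Literature.MathematicalPhysics.QuantumFieldTheory.wilsonAction (fundamentalRep (Fin 2)) x = ∑ p : Plaquette 3 L, (2 - (fun y : (Edge 3 L × Fin 2 × Fin 2 × Bool → ℝ) => (([((p.1, p.2.1.1), false), ((Literature.MathematicalPhysics.QuantumFieldTheory.Site.shift p.1 p.2.1.1, p.2.1.2), false), ((Literature.MathematicalPhysics.QuantumFieldTheory.Site.shift p.1 p.2.1.2, p.2.1.1), true), ((p.1, p.2.1.2), true)].map (fun a : Edge 3 L × Bool => if a.2 then ((fun (ee : Edge 3 L) => Matrix.of fun (i j : Fin 2) => ((y (ee, i, j, false) : ℝ) : ℂ) + ((y (ee, i, j, true) : ℝ) : ℂ) * Complex.I)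 a.1)ᴴ else (fun (ee : Edge 3 L) => Matrix.of fun (i j : Fin 2) => ((y (ee, i, j, false) : ℝ) : ℂ) + ((y (ee, i, j, true) : ℝ) : ℂ) * Complex.I) a.1)).prod).trace.re) (coords x)) :=
    fun x => wilsonAction_eq_sum_word (L := L) x
  have hiP : ∀ p : Plaquette 3 L, Integrable (fun x => (fun y : (Edge 3 L × Fin 2 × Fin 2 × Bool → ℝ) => (([((p.1, p.2.1.1), false), ((Literature.MathematicalPhysics.QuantumFieldTheory.Site.shift p.1 p.2.1.1, p.2.1.2), false), ((Literature.MathematicalPhysics.QuantumFieldTheory.Site.shift p.1 p.2.1.2, p.2.1.1), true), ((p.1, p.2.1.2), true)].map (fun a : Edge 3 L × Bool => if a.2 then ((fun (ee : Edge 3 L) => Matrix.of fun (i j : Fin 2) => ((y (ee, i, j, false) : ℝ) : ℂ) + ((y (ee, i, j, true) : ℝ) : ℂ) * Complex.I) a.1)ᴴ else (fun (ee : Edge 3 L) => Matrix.of fun (i j : Fin 2) => ((y (ee, i, j, false) : ℝ) : ℂ) + ((y (ee, i, j, true) : ℝ) : ℂ) * Complex.I) a.1)).prod).trace.re) (coords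 x)) μ := fun p => integrable_of_continuous_of_compactSpace (hPc p) μ
  have hiWP : ∀ p : Plaquette 3 L, Integrable (fun x => (fun y : (Edge 3 L × Fin 2 × Fin 2 × Bool → ℝ) => ((l₁.map (fun a : Edge 3 L × Bool => if a.2 then ((fun (ee : Edge 3 L) => Matrix.of fun (i j : Fin 2) => ((y (ee, i, j, false) : ℝ) : ℂ) + ((y (ee, i, j, true) : ℝ) : ℂ) * Complex.I) a.1)ᴴ else (fun (ee : Edge 3 L) => Matrix.of fun (i j : Fin 2) => ((y (ee, i, j, false) : ℝ) : ℂ) + ((y (ee, i, j, true) : ℝ) : ℂ) * Complex.I) a.1)).prod).trace.re) (coords x) * (fun y : (Edge 3 L × Fin 2 × Fin 2 × Bool → ℝ) => (([((p.1, p.2.1.1), false), ((Literature.MathematicalPhysics.QuantumFieldTheory.Site.shift p.1 p.2.1.1, p.2.1.2), false), ((Literature.MathematicalPhysics.QuantumFieldTheory.Site.shift p.1 p.2.1.2, p.2.1.1), true), ((p.1, p.2.1.2), true)].map (fun a : Edge 3 L × Bool => if a.2 then ((fun (ee : Edge 3 L) => Matrix.of fun (i j : Fin 2) => ((y (ee,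 i, j, false) : ℝ) : ℂ) + ((y (ee, i, j, true) : ℝ) : ℂ) * Complex.I) a.1)ᴴ else (fun (ee : Edge 3 L) => Matrix.of fun (i j : Fin 2) => ((y (ee, i, j, false) : ℝ) : ℂ) + ((y (ee, i, j, true) : ℝ) : ℂ) * Complex.I) a.1)).prod).trace.re) (coords x)) μ := fun p =>
    integrable_of_continuous_of_compactSpace (hWc.mul (hPc p)) μ
  have hiW : Integrable (fun x => (fun y : (Edge 3 L × Fin 2 × Fin 2 × Bool → ℝ) => ((l₁.map (fun a : Edge 3 L × Bool => if a.2 then ((fun (ee : Edge 3 L) => Matrix.of fun (i j : Fin 2) => ((y (ee, i, j, false) : ℝ) : ℂ) + ((y (ee, i, j, true) : ℝ) : ℂ) * Complex.I) a.1)ᴴ else (fun (ee : Edge 3 L) => Matrix.of fun (i j : Fin 2) => ((y (ee, i, j, false) : ℝ) : ℂ) + ((y (ee, i, j, true) : ℝ) : ℂ) * Complex.I) a.1)).prod).trace.re) (coords x)) μ := integrable_of_continuous_of_compactSpace hWc μ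
  have e1 : ∫ x, (fun y : (Edge 3 L × Fin 2 × Fin 2 × Bool → ℝ) => ((l₁.map (fun a : Edge 3 L × Bool => if a.2 then ((fun (ee : Edge 3 L) => Matrix.of fun (i j : Fin 2) => ((y (ee, i, j, false) : ℝ) : ℂ) + ((y (ee, i, j, true) : ℝ) : ℂ) * Complex.I) a.1)ᴴ else (fun (ee : Edge 3 L) => Matrix.of fun (i j : Fin 2) => ((y (ee, i, j, false) : ℝ) : ℂ) + ((y (ee, i, j, true) : ℝ) : ℂ) * Complex.I) a.1)).prod).trace.re) (coords x) * Literature.MathematicalPhysics.QuantumFieldTheory.wilsonAction (fundamentalRep (Fin 2)) x ∂μ =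
      ∑ p : Plaquette 3 L, (2 * (∫ x, (fun y : (Edge 3 L × Fin 2 × Fin 2 × Bool → ℝ) => ((l₁.map (fun a : Edge 3 L × Bool => if a.2 then ((fun (ee : Edge 3 L) => Matrix.of fun (i j : Fin 2) => ((y (ee, i, j, false) : ℝ) : ℂ) + ((y (ee, i, j, true) : ℝ) : ℂ) * Complex.I) a.1)ᴴ else (fun (ee : Edge 3 L) => Matrix.of fun (i j : Fin 2) => ((y (ee, i, j, false) : ℝ) : ℂ) + ((y (ee, i, j, true) : ℝ) : ℂ) * Complex.I) a.1)).prod).trace.re) (coords x) ∂μ) - ∫ x, (fun y : (Edge 3 L × Fin 2 × Fin 2 × Bool → ℝ) => ((l₁.map (fun a : Edge 3 L × Bool => if a.2 then ((fun (ee : Edge 3 L) => Matrix.of fun (i j : Fin 2) => ((y (ee, i, j, false) : ℝ) : ℂ) + ((y (ee, i, j, true) : ℝ) : ℂ) * Complex.I) a.1)ᴴ else (fun (ee : Edge 3 L) => Matrix.of fun (i j : Fin 2) => ((y (ee, i, j, false) : ℝ) : ℂ) + ((y (ee, i, j, true) : ℝ) : ℂ) * Complex.I) a.1)).prod).trace.re)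 (coords x) * (fun y : (Edge 3 L × Fin 2 × Fin 2 × Bool → ℝ) => (([((p.1, p.2.1.1), false), ((Literature.MathematicalPhysics.QuantumFieldTheory.Site.shift p.1 p.2.1.1, p.2.1.2), false), ((Literature.MathematicalPhysics.QuantumFieldTheory.Site.shift p.1 p.2.1.2, p.2.1.1), true), ((p.1, p.2.1.2), true)].map (fun a : Edge 3 L × Bool => if a.2 then ((fun (ee : Edge 3 L) => Matrix.of fun (i j : Fin 2) => ((y (ee, i, j, false) : ℝ) : ℂ) + ((y (ee, i, j, true) : ℝ) : ℂ) * Complex.I) a.1)ᴴ else (fun (ee : Edge 3 L) => Matrix.of fun (i j : Fin 2) => ((y (ee, i, j, false) : ℝ) : ℂ) + ((y (ee, i, j, true) : ℝ) : ℂ) * Complex.I) a.1)).prod).trace.re) (coords x) ∂μ) := by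
    have hWS : ∀ x : GaugeConfig 3 L (Matrix.specialUnitaryGroup (Fin 2) ℂ),
        (fun y : (Edge 3 L × Fin 2 × Fin 2 × Bool → ℝ) => ((l₁.map (fun a : Edge 3 L × Bool => if a.2 then ((fun (ee : Edge 3 L) => Matrix.of fun (i j : Fin 2) => ((y (ee, i, j, false) : ℝ) : ℂ) + ((y (ee, i, j, true) : ℝ) : ℂ) * Complex.I) a.1)ᴴ else (fun (ee : Edge 3 L) => Matrix.of fun (i j : Fin 2) => ((y (ee, i, j, false) : ℝ) : ℂ) + ((y (ee, i, j, true) : ℝ) : ℂ) * Complex.I) a.1)).prod).trace.re) (coords x) * Literature.MathematicalPhysics.QuantumFieldTheory.wilsonAction (fundamentalRep (Fin 2)) x =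
          ∑ p : Plaquette 3 L, (2 * (fun y : (Edge 3 L × Fin 2 × Fin 2 × Bool → ℝ) => ((l₁.map (fun a : Edge 3 L × Bool => if a.2 then ((fun (ee : Edge 3 L) => Matrix.of fun (i j : Fin 2) => ((y (ee, i, j, false) : ℝ) : ℂ) + ((y (ee, i, j, true) : ℝ) : ℂ) * Complex.I) a.1)ᴴ else (fun (ee : Edge 3 L) => Matrix.of fun (i j : Fin 2) => ((y (ee, i, j, false) : ℝ) : ℂ) + ((y (ee, i, j, true) : ℝ) : ℂ) * Complex.I) a.1)).prod).trace.re) (coords x) - (fun y : (Edge 3 L × Fin 2 × Fin 2 × Bool → ℝ) => ((l₁.map (fun a : Edge 3 L × Bool => if a.2 then ((fun (ee : Edge 3 L) => Matrix.of fun (i j : Fin 2) => ((y (ee, i, j, false) : ℝ) : ℂ) + ((y (ee, i, j, true) : ℝ) : ℂ) * Complex.I) a.1)ᴴ else (fun (ee : Edge 3 L) => Matrix.of fun (i j : Fin 2) => ((y (ee, i, j, false) : ℝ) : ℂ) + ((y (ee, i, j, true) : ℝ) : ℂ) * Complex.I) a.1)).prod).trace.re) (coords x) * (fun y : (Edge 3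 L × Fin 2 × Fin 2 × Bool → ℝ) => (([((p.1, p.2.1.1), false), ((Literature.MathematicalPhysics.QuantumFieldTheory.Site.shift p.1 p.2.1.1, p.2.1.2), false), ((Literature.MathematicalPhysics.QuantumFieldTheory.Site.shift p.1 p.2.1.2, p.2.1.1), true), ((p.1, p.2.1.2), true)].map (fun a : Edge 3 L × Bool => if a.2 then ((fun (ee : Edge 3 L) => Matrix.of fun (i j : Fin 2) => ((y (ee, i, j, false) : ℝ) : ℂ) + ((y (ee, i, j, true) : ℝ) : ℂ) * Complex.I) a.1)ᴴ else (fun (ee : Edge 3 L) => Matrix.of fun (i j : Fin 2) => ((y (ee, i, j, false) : ℝ) : ℂ) + ((y (ee, i, j, true) : ℝ) : ℂ) * Complex.I) a.1)).prod).trace.re) (coords x)) := fun x => by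
      rw [hS x, Finset.mul_sum]
      exact Finset.sum_congr rfl fun p _ => by ring
    rw [integral_congr_ae (ae_of_all _ hWS),
      integral_finsetSum (s := Finset.univ)
        (f := fun (p : Plaquette 3 L) (x : GaugeConfig 3 L (Matrix.specialUnitaryGroup (Fin 2) ℂ)) =>
          2 * (fun y : (Edge 3 L × Fin 2 × Fin 2 × Bool → ℝ) => ((l₁.map (fun a : Edge 3 L × Bool => if a.2 then ((fun (ee : Edge 3 L) => Matrix.of fun (i j : Fin 2) => ((y (ee, i, j, false) : ℝ) : ℂ) + ((y (ee, i, j, true) : ℝ) : ℂ) * Complex.I) a.1)ᴴ else (fun (ee : Edge 3 L) => Matrix.of fun (i j : Fin 2) => ((y (ee, i, j, false) : ℝ) : ℂ) + ((y (ee, i, j, true) : ℝ) : ℂ) * Complex.I) a.1)).prod).trace.re) (coords x) - (fun y : (Edge 3 L × Fin 2 × Fin 2 × Bool → ℝ) => ((l₁.map (fun a : Edge 3 L × Bool => if a.2 then ((fun (ee : Edge 3 L) => Matrix.of fun (i j : Fin 2) => ((y (ee, i, j, false) : ℝ) : ℂ) + ((y (ee, i, j, true) : ℝ) : ℂ) *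 Complex.I) a.1)ᴴ else (fun (ee : Edge 3 L) => Matrix.of fun (i j : Fin 2) => ((y (ee, i, j, false) : ℝ) : ℂ) + ((y (ee, i, j, true) : ℝ) : ℂ) * Complex.I) a.1)).prod).trace.re) (coords x) * (fun y : (Edge 3 L × Fin 2 × Fin 2 × Bool → ℝ) => (([((p.1, p.2.1.1), false), ((Literature.MathematicalPhysics.QuantumFieldTheory.Site.shift p.1 p.2.1.1, p.2.1.2), false), ((Literature.MathematicalPhysics.QuantumFieldTheory.Site.shift p.1 p.2.1.2, p.2.1.1), true), ((p.1, p.2.1.2), true)].map (fun a : Edge 3 L × Bool => if a.2 then ((fun (ee : Edge 3 L) => Matrix.of fun (i j : Fin 2) => ((y (ee, i, j, false) : ℝ) : ℂ) + ((y (ee, i, j, true) : ℝ) : ℂ) * Complex.I) a.1)ᴴ else (fun (ee : Edge 3 L) => Matrix.of fun (i j : Fin 2) => ((y (ee, i, j, false) : ℝ) : ℂ) + ((y (ee, i, j, true) : ℝ) : ℂ) * Complex.I) a.1)).prod).trace.re) (coords x))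
        (fun p _ => (hiW.const_mul 2).sub (hiWP p))]
    refine Finset.sum_congr rfl fun p _ => ?_
    rw [integral_sub (hiW.const_mul 2) (hiWP p), MeasureTheory.integral_const_mul]
  have e2 : ∫ x, Literature.MathematicalPhysics.QuantumFieldTheory.wilsonAction (fundamentalRep (Fin 2)) x ∂μ =
      ∑ p : Plaquette 3 L, (2 - ∫ x, (fun y : (Edge 3 L × Fin 2 × Fin 2 × Bool → ℝ) => (([((p.1, p.2.1.1), false), ((Literature.MathematicalPhysics.QuantumFieldTheory.Site.shift p.1 p.2.1.1, p.2.1.2), false), ((Literature.MathematicalPhysics.QuantumFieldTheory.Site.shift p.1 p.2.1.2, p.2.1.1), true), ((p.1, p.2.1.2), true)].map (fun a : Edge 3 L × Bool => if a.2 then ((fun (ee : Edge 3 L) => Matrix.of fun (i j : Fin 2) => ((y (ee, i, j, false) : ℝ) : ℂ) + ((y (ee, i, j, true) : ℝ) : ℂ) * Complex.I) a.1)ᴴ else (fun (ee : Edge 3 L) => Matrix.of fun (i j : Fin 2) => ((y (ee, i, j, false) : ℝ) : ℂ) + ((y (ee, i, j, true) : ℝ) : ℂ) * Complex.I) a.1)).prod).trace.re)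 (coords x) ∂μ) := by
    rw [integral_congr_ae (ae_of_all _ hS),
      integral_finsetSum (s := Finset.univ)
        (f := fun (p : Plaquette 3 L) (x : GaugeConfig 3 L (Matrix.specialUnitaryGroup (Fin 2) ℂ)) => 2 - (fun y : (Edge 3 L × Fin 2 × Fin 2 × Bool → ℝ) => (([((p.1, p.2.1.1), false), ((Literature.MathematicalPhysics.QuantumFieldTheory.Site.shift p.1 p.2.1.1, p.2.1.2), false), ((Literature.MathematicalPhysics.QuantumFieldTheory.Site.shift p.1 p.2.1.2, p.2.1.1), true), ((p.1, p.2.1.2), true)].map (fun a : Edge 3 L × Bool => if a.2 then ((fun (ee : Edge 3 L) => Matrix.of fun (i j : Fin 2) => ((y (ee, i, j, false) : ℝ) : ℂ) + ((y (ee, i, j, true) : ℝ) : ℂ) * Complex.I) a.1)ᴴ else (fun (ee : Edge 3 L) => Matrix.of fun (i j : Fin 2) => ((y (ee, i, j, false) : ℝ) : ℂ) + ((y (ee, i, j, true) : ℝ) : ℂ) * Complex.I) a.1)).prod).trace.re) (coords x))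
        (fun p _ => (integrable_const (2:ℝ)).sub (hiP p))]
    refine Finset.sum_congr rfl fun p _ => ?_
    rw [integral_sub (integrable_const _) (hiP p), MeasureTheory.integral_const, smul_eq_mul, probReal_univ, one_mul]
  rw [e1, e2, Finset.mul_sum, ← Finset.sum_sub_distrib]
  have e3 : ∀ p : Plaquette 3 L, (2 * (∫ x, (fun y : (Edge 3 L × Fin 2 × Fin 2 × Bool → ℝ) => ((l₁.map (fun a : Edge 3 L × Bool => if a.2 then ((fun (ee : Edge 3 L) => Matrix.of fun (i j : Fin 2) => ((y (ee, i, j, false) : ℝ) : ℂ) + ((y (ee, i, j, true) : ℝ) : ℂ) * Complex.I) a.1)ᴴ else (fun (ee : Edge 3 L) => Matrix.of fun (i j : Fin 2) => ((y (ee, i, j, false) : ℝ) : ℂ) + ((y (ee, i, j, true) : ℝ) : ℂ) * Complex.I) a.1)).prod).trace.re) (coords x) ∂μ) - ∫ x, (fun y : (Edge 3 L × Fin 2 × Fin 2 × Bool → ℝ) => ((l₁.map (fun a : Edge 3 L × Bool => if a.2 then ((fun (ee : Edge 3 L) => Matrix.of fun (i j : Fin 2) => ((y (ee, i, j, false) :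 ℝ) : ℂ) + ((y (ee, i, j, true) : ℝ) : ℂ) * Complex.I) a.1)ᴴ else (fun (ee : Edge 3 L) => Matrix.of fun (i j : Fin 2) => ((y (ee, i, j, false) : ℝ) : ℂ) + ((y (ee, i, j, true) : ℝ) : ℂ) * Complex.I) a.1)).prod).trace.re) (coords x) * (fun y : (Edge 3 L × Fin 2 × Fin 2 × Bool → ℝ) => (([((p.1, p.2.1.1), false), ((Literature.MathematicalPhysics.QuantumFieldTheory.Site.shift p.1 p.2.1.1, p.2.1.2), false), ((Literature.MathematicalPhysics.QuantumFieldTheory.Site.shift p.1 p.2.1.2, p.2.1.1), true), ((p.1, p.2.1.2), true)].map (fun a : Edge 3 L × Bool => if a.2 then ((fun (ee : Edge 3 L) => Matrix.of fun (i j : Fin 2) => ((y (ee, i, j, false) : ℝ) : ℂ) + ((y (ee, i, j, true) : ℝ) : ℂ) * Complex.I) a.1)ᴴ else (fun (ee : Edge 3 L) => Matrix.of fun (i j : Fin 2) => ((y (ee, i, j, false) : ℝ) : ℂ) + ((y (ee, i, j, true) : ℝ) : ℂ) * Complex.I) a.1)).prod).trace.re) (coords x) ∂μ) -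
      (∫ x, (fun y : (Edge 3 L × Fin 2 × Fin 2 × Bool → ℝ) => ((l₁.map (fun a : Edge 3 L × Bool => if a.2 then ((fun (ee : Edge 3 L) => Matrix.of fun (i j : Fin 2) => ((y (ee, i, j, false) : ℝ) : ℂ) + ((y (ee, i, j, true) : ℝ) : ℂ) * Complex.I) a.1)ᴴ else (fun (ee : Edge 3 L) => Matrix.of fun (i j : Fin 2) => ((y (ee, i, j, false) : ℝ) : ℂ) + ((y (ee, i, j, true) : ℝ) : ℂ) * Complex.I) a.1)).prod).trace.re) (coords x) ∂μ) * (2 - ∫ x, (fun y : (Edge 3 L × Fin 2 × Fin 2 × Bool → ℝ) => (([((p.1, p.2.1.1), false), ((Literature.MathematicalPhysics.QuantumFieldTheory.Site.shift p.1 p.2.1.1, p.2.1.2), false), ((Literature.MathematicalPhysics.QuantumFieldTheory.Site.shift p.1 p.2.1.2, p.2.1.1), true), ((p.1, p.2.1.2), true)].map (fun a : Edge 3 L × Bool => if a.2 then ((fun (ee : Edge 3 L) => Matrix.of fun (i j : Fin 2) => ((y (ee, i, j, false) : ℝ) : ℂ) + ((y (ee, i, j, true) : ℝ) : ℂ) *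 Complex.I) a.1)ᴴ else (fun (ee : Edge 3 L) => Matrix.of fun (i j : Fin 2) => ((y (ee, i, j, false) : ℝ) : ℂ) + ((y (ee, i, j, true) : ℝ) : ℂ) * Complex.I) a.1)).prod).trace.re) (coords x) ∂μ) = -((∫ x, (fun y : (Edge 3 L × Fin 2 × Fin 2 × Bool → ℝ) => ((l₁.map (fun a : Edge 3 L × Bool => if a.2 then ((fun (ee : Edge 3 L) => Matrix.of fun (i j : Fin 2) => ((y (ee, i, j, false) : ℝ) : ℂ) + ((y (ee, i, j, true) : ℝ) : ℂ) * Complex.I) a.1)ᴴ else (fun (ee : Edge 3 L) => Matrix.of fun (i j : Fin 2) => ((y (ee, i, j, false) : ℝ) : ℂ) + ((y (ee, i, j, true) : ℝ) : ℂ) * Complex.I) a.1)).prod).trace.re) (coords x) * (fun y : (Edge 3 L × Fin 2 × Fin 2 × Bool → ℝ) => (([((p.1, p.2.1.1), false), ((Literature.MathematicalPhysics.QuantumFieldTheory.Site.shift p.1 p.2.1.1, p.2.1.2), false), ((Literature.MathematicalPhysics.QuantumFieldTheory.Site.shift p.1 p.2.1.2, p.2.1.1), true), ((p.1, p.2.1.2),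 true)].map (fun a : Edge 3 L × Bool => if a.2 then ((fun (ee : Edge 3 L) => Matrix.of fun (i j : Fin 2) => ((y (ee, i, j, false) : ℝ) : ℂ) + ((y (ee, i, j, true) : ℝ) : ℂ) * Complex.I) a.1)ᴴ else (fun (ee : Edge 3 L) => Matrix.of fun (i j : Fin 2) => ((y (ee, i, j, false) : ℝ) : ℂ) + ((y (ee, i, j, true) : ℝ) : ℂ) * Complex.I) a.1)).prod).trace.re) (coords x) ∂(wilsonMeasure (d := 3) (L := L) (fundamentalRep (Fin 2)) β')) - (∫ x, (fun y : (Edge 3 L × Fin 2 × Fin 2 × Bool → ℝ) => ((l₁.map (fun a : Edge 3 L × Bool => if a.2 then ((fun (ee : Edge 3 L) => Matrix.of fun (i j : Fin 2) => ((y (ee, i, j, false) : ℝ) : ℂ) + ((y (ee, i, j, true) : ℝ) : ℂ) * Complex.I) a.1)ᴴ else (fun (ee : Edge 3 L) => Matrix.of fun (i j : Fin 2) => ((y (ee, i, j, false) : ℝ) : ℂ) + ((y (ee, i, j, true) : ℝ) : ℂ) * Complex.I) a.1)).prod).trace.re) (coords x) ∂(wilsonMeasure (d := 3) (L := L) (fundamentalRep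 (Fin 2)) β')) * (∫ x, (fun y : (Edge 3 L × Fin 2 × Fin 2 × Bool → ℝ) => (([((p.1, p.2.1.1), false), ((Literature.MathematicalPhysics.QuantumFieldTheory.Site.shift p.1 p.2.1.1, p.2.1.2), false), ((Literature.MathematicalPhysics.QuantumFieldTheory.Site.shift p.1 p.2.1.2, p.2.1.1), true), ((p.1, p.2.1.2), true)].map (fun a : Edge 3 L × Bool => if a.2 then ((fun (ee : Edge 3 L) => Matrix.of fun (i j : Fin 2) => ((y (ee, i, j, false) : ℝ) : ℂ) + ((y (ee, i, j, true) : ℝ) : ℂ) * Complex.I) a.1)ᴴ else (fun (ee : Edge 3 L) => Matrix.of fun (i j : Fin 2) => ((y (ee, i, j, false) : ℝ) : ℂ) + ((y (ee, i, j, true) : ℝ) : ℂ) * Complex.I) a.1)).prod).trace.re) (coords x) ∂(wilsonMeasure (d := 3) (L := L) (fundamentalRep (Fin 2)) β'))) := fun p => by ring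
  simp_rw [e3]
  rw [Finset.sum_neg_distrib, abs_neg]
  exact (Finset.abs_sum_le_sum_abs _ _).trans (sum_plaquette_covariance_abs_le L β' hβ l₁ hl₁)


/-! ## §2. The coupling derivative of a Wilson loop expectation is bounded uniformly in the volume -/

/-- **The Wilson family is an exponential family through each of its members**: `μ_b = μ_(β').tilted(t ↦ (b − β')·(−S_W))`. [folklore] -/
theorem wilsonMeasure_eq_tilted_wilsonMeasure_su2 (L : ℕ) [NeZero L] (β' b : ℝ) :
    (wilsonMeasure (d := 3) (L := L) (fundamentalRep (Fin 2)) b) = (wilsonMeasure (d := 3) (L := L) (fundamentalRep (Fin 2)) β').tilted (fun U => (b - β') * (-Literature.MathematicalPhysics.QuantumFieldTheory.wilsonAction (fundamentalRep (Fin 2)) U)) := by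
  classical
  haveI := secondCountableTopology_su2
  haveI := borelSpace_config L
  set π : Measure (GaugeConfig 3 L (Matrix.specialUnitaryGroup (Fin 2) ℂ)) :=
    Measure.pi fun _ : Edge 3 L => haarProbability (Matrix.specialUnitaryGroup (Fin 2) ℂ) with hπ
  haveI : IsProbabilityMeasure π := by rw [hπ]; infer_instance
  have hρ := continuous_fundamentalRep (Fin 2)
  obtain ⟨B, hB⟩ := Literature.MathematicalPhysics.QuantumFieldTheory.exists_abs_wilsonAction_le (d := 3) (L := L) (fundamentalRep (Fin 2)) hρ
  have hSm := Literature.MathematicalPhysics.QuantumFieldTheory.measurable_wilsonAction (d := 3) (L := L) (G := Matrix.specialUnitaryGroup (Fin 2) ℂ) (fundamentalRep (Fin 2)) hρ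
  have hint : Integrable (fun U : GaugeConfig 3 L (Matrix.specialUnitaryGroup (Fin 2) ℂ) => Real.exp (-β' * Literature.MathematicalPhysics.QuantumFieldTheory.wilsonAction (fundamentalRep (Fin 2)) U)) π := by
    refine Integrable.of_bound ((hSm.const_mul _).exp).aestronglyMeasurable (Real.exp (|β'| * B)) (ae_of_all _ fun U => ?_)
    rw [Real.norm_eq_abs, Real.abs_exp, Real.exp_le_exp]
    have h : |β' * Literature.MathematicalPhysics.QuantumFieldTheory.wilsonAction (fundamentalRep (Fin 2)) U| ≤ |β'| * B := by
      rw [abs_mul]; exact mul_le_mul_of_nonneg_left (hB U) (abs_nonneg _)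
    have := (abs_le.1 h).1
    linarith
  rw [Literature.MathematicalPhysics.QuantumLattice.wilsonMeasure_eq_tilted_pi (d := 3) (L := L) (fundamentalRep (Fin 2)) hρ b,
    Literature.MathematicalPhysics.QuantumLattice.wilsonMeasure_eq_tilted_pi (d := 3) (L := L) (fundamentalRep (Fin 2)) hρ β', ← hπ,
    tilted_tilted hint]
  congr 1
  funext U
  simp only [Pi.add_apply]
  ring

/-- ★★ **The coupling derivative of a Wilson loop expectation is (minus) its covariance with the action** — every coupling `β'`, every `L`:
`d/db|_(b=β') ⟨Re tr w⟩_(μ_b) = −Cov_(μ_β')(Re tr w, S_W)` (`wilsonMeasure ρ b = Haar^⊗E` tilted by `−b·S_W`; first cumulant of a Gibbs tilt,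
`ToronCumulant.hasDerivAt_integral_tilted_zero`). [folklore; cite: Wilson1974, §III] -/
theorem hasDerivAt_wilson_loop_expectation (L : ℕ) [NeZero L] (β' : ℝ) (l₁ : List (Edge 3 L × Bool)) :
    let coords : GaugeConfig 3 L (Matrix.specialUnitaryGroup (Fin 2) ℂ) → (Edge 3 L × Fin 2 × Fin 2 × Bool → ℝ) :=
      fun V q => (fun z : ℂ => if q.2.2.2 then z.im else z.re)
        ((fundamentalRep (Fin 2) (V q.1) : Matrix (Fin 2) (Fin 2) ℂ) q.2.1 q.2.2.1)
    HasDerivAt (fun b : ℝ => ∫ x, (fun y : (Edge 3 L × Fin 2 × Fin 2 × Bool → ℝ) => ((l₁.map (fun a : Edge 3 L × Bool => if a.2 then ((fun (ee : Edge 3 L) => Matrix.of fun (i j : Fin 2) => ((y (ee, i, j, false) : ℝ) : ℂ) + ((y (ee, i, j, true) : ℝ) : ℂ) * Complex.I) a.1)ᴴ else (fun (ee : Edge 3 L) => Matrix.of fun (i j : Fin 2) => ((y (ee, i, j, false) : ℝ) : ℂ) + ((y (ee, i, j, true) : ℝ) : ℂ) * Complex.I) a.1)).prod).trace.re) (coords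 x) ∂(wilsonMeasure (d := 3) (L := L) (fundamentalRep (Fin 2)) b))
      (-((∫ x, (fun y : (Edge 3 L × Fin 2 × Fin 2 × Bool → ℝ) => ((l₁.map (fun a : Edge 3 L × Bool => if a.2 then ((fun (ee : Edge 3 L) => Matrix.of fun (i j : Fin 2) => ((y (ee, i, j, false) : ℝ) : ℂ) + ((y (ee, i, j, true) : ℝ) : ℂ) * Complex.I) a.1)ᴴ else (fun (ee : Edge 3 L) => Matrix.of fun (i j : Fin 2) => ((y (ee, i, j, false) : ℝ) : ℂ) + ((y (ee, i, j, true) : ℝ) : ℂ) * Complex.I) a.1)).prod).trace.re) (coords x) * Literature.MathematicalPhysics.QuantumFieldTheory.wilsonAction (fundamentalRep (Fin 2)) x ∂(wilsonMeasure (d := 3) (L := L) (fundamentalRep (Fin 2)) β')) -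
        (∫ x, (fun y : (Edge 3 L × Fin 2 × Fin 2 × Bool → ℝ) => ((l₁.map (fun a : Edge 3 L × Bool => if a.2 then ((fun (ee : Edge 3 L) => Matrix.of fun (i j : Fin 2) => ((y (ee, i, j, false) : ℝ) : ℂ) + ((y (ee, i, j, true) : ℝ) : ℂ) * Complex.I) a.1)ᴴ else (fun (ee : Edge 3 L) => Matrix.of fun (i j : Fin 2) => ((y (ee, i, j, false) : ℝ) : ℂ) + ((y (ee, i, j, true) : ℝ) : ℂ) * Complex.I) a.1)).prod).trace.re) (coords x) ∂(wilsonMeasure (d := 3) (L := L) (fundamentalRep (Fin 2)) β')) * (∫ x, Literature.MathematicalPhysics.QuantumFieldTheory.wilsonAction (fundamentalRep (Fin 2)) x ∂(wilsonMeasure (d := 3) (L := L) (fundamentalRep (Fin 2)) β')))) β' := by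
  intro coords
  classical
  haveI := secondCountableTopology_su2
  haveI := borelSpace_config L
  set μ : Measure (GaugeConfig 3 L (Matrix.specialUnitaryGroup (Fin 2) ℂ)) := (wilsonMeasure (d := 3) (L := L) (fundamentalRep (Fin 2)) β') with hμ
  haveI : IsProbabilityMeasure μ :=
    isProbabilityMeasure_wilsonMeasure (d := 3) (L := L) (fundamentalRep (Fin 2)) (continuous_fundamentalRep (Fin 2)) β'
  have hρ := continuous_fundamentalRep (Fin 2)
  have hco : Continuous coords := continuous_coords (L := L)
  have hWc : Continuous fun x => (fun y : (Edge 3 L × Fin 2 × Fin 2 × Bool → ℝ) => ((l₁.map (fun a : Edge 3 L × Bool => if a.2 then ((fun (ee : Edge 3 L) => Matrix.of fun (i j : Fin 2) => ((y (ee, i, j, false) : ℝ) : ℂ) + ((y (ee, i, j, true) : ℝ) : ℂ) * Complex.I) a.1)ᴴ else (fun (ee : Edge 3 L) => Matrix.of fun (i j : Fin 2) => ((y (ee, i, j, false) : ℝ) : ℂ) + ((y (ee, i, j, true) : ℝ) : ℂ) * Complex.I) a.1)).prod).trace.re) (coords x) := (contDiff_word (L := L) l₁ (m := 1)).continuous.comp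 hco
  obtain ⟨MW, -, hMW⟩ := exists_abs_le_of_continuous hWc
  obtain ⟨B, hB⟩ := Literature.MathematicalPhysics.QuantumFieldTheory.exists_abs_wilsonAction_le (d := 3) (L := L) (fundamentalRep (Fin 2)) hρ
  have hSm := Literature.MathematicalPhysics.QuantumFieldTheory.measurable_wilsonAction (d := 3) (L := L) (G := Matrix.specialUnitaryGroup (Fin 2) ℂ) (fundamentalRep (Fin 2)) hρ
  have hXm : Measurable fun U : GaugeConfig 3 L (Matrix.specialUnitaryGroup (Fin 2) ℂ) => -Literature.MathematicalPhysics.QuantumFieldTheory.wilsonAction (fundamentalRep (Fin 2)) U := hSm.neg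
  have hXb : ∀ U : GaugeConfig 3 L (Matrix.specialUnitaryGroup (Fin 2) ℂ), |-Literature.MathematicalPhysics.QuantumFieldTheory.wilsonAction (fundamentalRep (Fin 2)) U| ≤ B := fun U => by rw [abs_neg]; exact hB U
  have hD := Literature.MathematicalPhysics.QuantumFieldTheory.ToronCumulant.hasDerivAt_integral_tilted_zero (μ := μ) hXm hWc.measurable hXb hMW
  -- `b ↦ ∫ W dμ_b` is `t ↦ ∫ W d(μ.tilted (t·X))` precomposed with `b ↦ b − β'`
  have hfun : (fun b : ℝ => ∫ x, (fun y : (Edge 3 L × Fin 2 × Fin 2 × Bool → ℝ) => ((l₁.map (fun a : Edge 3 L × Bool => if a.2 then ((fun (ee : Edge 3 L) => Matrix.of fun (i j : Fin 2) => ((y (ee, i, j, false) : ℝ) : ℂ) + ((y (ee, i, j, true) : ℝ) : ℂ) * Complex.I) a.1)ᴴ else (fun (ee : Edge 3 L) => Matrix.of fun (i j : Fin 2) => ((y (ee, i, j, false) : ℝ) : ℂ) + ((y (ee, i, j, true) : ℝ) : ℂ) * Complex.I) a.1)).prod).trace.re) (coords x) ∂(wilsonMeasure (d := 3) (L := L)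 (fundamentalRep (Fin 2)) b)) =
      (fun t : ℝ => ∫ x, (fun y : (Edge 3 L × Fin 2 × Fin 2 × Bool → ℝ) => ((l₁.map (fun a : Edge 3 L × Bool => if a.2 then ((fun (ee : Edge 3 L) => Matrix.of fun (i j : Fin 2) => ((y (ee, i, j, false) : ℝ) : ℂ) + ((y (ee, i, j, true) : ℝ) : ℂ) * Complex.I) a.1)ᴴ else (fun (ee : Edge 3 L) => Matrix.of fun (i j : Fin 2) => ((y (ee, i, j, false) : ℝ) : ℂ) + ((y (ee, i, j, true) : ℝ) : ℂ) * Complex.I) a.1)).prod).trace.re) (coords x) ∂(μ.tilted fun U => t * (-Literature.MathematicalPhysics.QuantumFieldTheory.wilsonAction (fundamentalRep (Fin 2)) U))) ∘ (fun b : ℝ => b - β') := by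
    funext b
    simp only [Function.comp_apply]
    rw [wilsonMeasure_eq_tilted_wilsonMeasure_su2 L β' b]
  rw [hfun]
  have hsub : HasDerivAt (fun b : ℝ => b - β') 1 β' := (hasDerivAt_id β').sub_const β'
  have hcomp := HasDerivAt.comp β' (h₂ := fun t : ℝ => ∫ x, (fun y : (Edge 3 L × Fin 2 × Fin 2 × Bool → ℝ) => ((l₁.map (fun a : Edge 3 L × Bool => if a.2 then ((fun (ee : Edge 3 L) => Matrix.of fun (i j : Fin 2) => ((y (ee, i, j, false) : ℝ) : ℂ) + ((y (ee, i, j, true) : ℝ) : ℂ) * Complex.I) a.1)ᴴ else (fun (ee : Edge 3 L) => Matrix.of fun (i j : Fin 2) => ((y (ee, i, j, false) : ℝ) : ℂ) + ((y (ee, i, j, true) : ℝ) : ℂ) * Complex.I) a.1)).prod).trace.re) (coords x) ∂(μ.tilted fun U => t * (-Literature.MathematicalPhysics.QuantumFieldTheory.wilsonAction (fundamentalRep (Fin 2)) U))) (by rw [sub_self]; exact hD) hsub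
  rw [mul_one] at hcomp
  refine hcomp.congr_deriv ?_
  have e1 : ∫ x, (fun y : (Edge 3 L × Fin 2 × Fin 2 × Bool → ℝ) => ((l₁.map (fun a : Edge 3 L × Bool => if a.2 then ((fun (ee : Edge 3 L) => Matrix.of fun (i j : Fin 2) => ((y (ee, i, j, false) : ℝ) : ℂ) + ((y (ee, i, j, true) : ℝ) : ℂ) * Complex.I) a.1)ᴴ else (fun (ee : Edge 3 L) => Matrix.of fun (i j : Fin 2) => ((y (ee, i, j, false) : ℝ) : ℂ) + ((y (ee, i, j, true) : ℝ) : ℂ) * Complex.I) a.1)).prod).trace.re) (coords x) * (-Literature.MathematicalPhysics.QuantumFieldTheory.wilsonAction (fundamentalRep (Fin 2)) x) ∂μ = -∫ x, (fun y : (Edge 3 L × Fin 2 × Fin 2 × Bool → ℝ) => ((l₁.map (fun a : Edge 3 L × Bool => if a.2 then ((fun (ee : Edge 3 L) => Matrix.of fun (i j : Fin 2) => ((y (ee, i, j, false) : ℝ) : ℂ) + ((y (ee, i, j, true) : ℝ) : ℂ) * Complex.I) a.1)ᴴ else (fun (ee : Edge 3 L) => Matrix.of fun (i j : Fin 2) =>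 ((y (ee, i, j, false) : ℝ) : ℂ) + ((y (ee, i, j, true) : ℝ) : ℂ) * Complex.I) a.1)).prod).trace.re) (coords x) * Literature.MathematicalPhysics.QuantumFieldTheory.wilsonAction (fundamentalRep (Fin 2)) x ∂μ := by
    rw [← integral_neg]; exact integral_congr_ae (ae_of_all _ fun x => by ring)
  have e2 : ∫ x, (-Literature.MathematicalPhysics.QuantumFieldTheory.wilsonAction (fundamentalRep (Fin 2)) x) ∂μ = -∫ x, Literature.MathematicalPhysics.QuantumFieldTheory.wilsonAction (fundamentalRep (Fin 2)) x ∂μ := integral_neg _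
  rw [e1, e2]
  ring

/-- ★★★ **VOLUME-UNIFORM BOUND ON THE COUPLING DERIVATIVE OF WILSON LOOPS AT STRONG COUPLING** (`|β'| < 1/12`, every `L`, every non-empty word):
`|d/db ⟨Re tr w⟩_(μ_b)|_(b=β')| ≤ 3|w|·(1024π²|w|²/ρ)·e^κ·(1+12/κ)³/(1 − e^(−κ/2))`, `κ = ρ log 108/(2(λ+ρ))`, `ρ = 1 − 12|β'|`, `λ = (1300+4√2)|β'|` —
Wilson loop expectations respond to the coupling at a rate bounded INDEPENDENTLY OF THE VOLUME although the action has `3L³` terms: exponential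
clustering at work (`wilson_loop_action_covariance_abs_le`).  Fixed cut-off, strong-coupling window; the Yang–Mills mass gap is NOT proved. [folklore] -/
theorem abs_deriv_wilson_loop_expectation_le (L : ℕ) [NeZero L] (β' : ℝ) (hβ : |β'| < 1 / 12) (l₁ : List (Edge 3 L × Bool)) (hl₁ : l₁ ≠ []) :
    let coords : GaugeConfig 3 L (Matrix.specialUnitaryGroup (Fin 2) ℂ) → (Edge 3 L × Fin 2 × Fin 2 × Bool → ℝ) :=
      fun V q => (fun z : ℂ => if q.2.2.2 then z.im else z.re)
        ((fundamentalRep (Fin 2) (V q.1) : Matrix (Fin 2) (Fin 2) ℂ) q.2.1 q.2.2.1)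
    |deriv (fun b : ℝ => ∫ x, (fun y : (Edge 3 L × Fin 2 × Fin 2 × Bool → ℝ) => ((l₁.map (fun a : Edge 3 L × Bool => if a.2 then ((fun (ee : Edge 3 L) => Matrix.of fun (i j : Fin 2) => ((y (ee, i, j, false) : ℝ) : ℂ) + ((y (ee, i, j, true) : ℝ) : ℂ) * Complex.I) a.1)ᴴ else (fun (ee : Edge 3 L) => Matrix.of fun (i j : Fin 2) => ((y (ee, i, j, false) : ℝ) : ℂ) + ((y (ee, i, j, true) : ℝ) : ℂ) * Complex.I) a.1)).prod).trace.re) (coords x) ∂(wilsonMeasure (d := 3) (L := L) (fundamentalRep (Fin 2)) b)) β'| ≤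
      3 * (l₁.length : ℝ) * ((1024 * Real.pi ^ 2 * (l₁.length : ℝ) ^ 2 / (1 - 12 * |β'|)) * Real.exp ((1 - 12 * |β'|) * Real.log 108 / (2 * ((1300 + 4 * Real.sqrt 2) * |β'| + (1 - 12 * |β'|))))) * ((1 + 12 / ((1 - 12 * |β'|) * Real.log 108 / (2 * ((1300 + 4 * Real.sqrt 2) * |β'| + (1 - 12 * |β'|))))) ^ 3 / (1 - Real.exp (-(((1 - 12 * |β'|) * Real.log 108 / (2 * ((1300 + 4 * Real.sqrt 2) * |β'| + (1 - 12 * |β'|)))) / 2)))) := by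
  intro coords
  rw [(hasDerivAt_wilson_loop_expectation L β' l₁).deriv, abs_neg]
  exact wilson_loop_action_covariance_abs_le L β' hβ l₁ hl₁


/-! ## §3. The variance of the action is O(volume): a volume-uniform specific-heat bound -/

/-- ★★★ **THE VARIANCE OF THE WILSON ACTION IS LINEAR IN THE VOLUME** (`|β'| < 1/12`, every `L`):
`Var_(μ_β')(S_W) ≤ #𝒫 · 12·(16384π²/ρ)·e^κ·(1+12/κ)³/(1 − e^(−κ/2))`, `#𝒫 = 3L³` the number of plaquettes — i.e. the specific heat per plaquette
`Var(S_W)/#𝒫 = d²/dβ'² (log Z)/#𝒫` is bounded INDEPENDENTLY OF THE VOLUME in the strong-coupling window (`Var S_W = −Σ_p Cov(Re tr U_p, S_W)` and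
`wilson_loop_action_covariance_abs_le` for the plaquette words).  Fixed cut-off; the Yang–Mills mass gap is NOT proved. [folklore] -/
theorem wilson_action_variance_le (L : ℕ) [NeZero L] (β' : ℝ) (hβ : |β'| < 1 / 12) :
    ∫ x, (Literature.MathematicalPhysics.QuantumFieldTheory.wilsonAction (fundamentalRep (Fin 2)) x - ∫ z, Literature.MathematicalPhysics.QuantumFieldTheory.wilsonAction (fundamentalRep (Fin 2)) z ∂(wilsonMeasure (d := 3) (L := L) (fundamentalRep (Fin 2)) β')) ^ 2 ∂(wilsonMeasure (d := 3) (L := L) (fundamentalRep (Fin 2)) β') ≤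
      (Fintype.card (Plaquette 3 L) : ℝ) * (3 * (4 : ℝ) * ((1024 * Real.pi ^ 2 * (4 : ℝ) ^ 2 / (1 - 12 * |β'|)) * Real.exp ((1 - 12 * |β'|) * Real.log 108 / (2 * ((1300 + 4 * Real.sqrt 2) * |β'| + (1 - 12 * |β'|))))) * ((1 + 12 / ((1 - 12 * |β'|) * Real.log 108 / (2 * ((1300 + 4 * Real.sqrt 2) * |β'| + (1 - 12 * |β'|))))) ^ 3 / (1 - Real.exp (-(((1 - 12 * |β'|) * Real.log 108 / (2 * ((1300 + 4 * Real.sqrt 2) * |β'| + (1 - 12 * |β'|)))) / 2))))) := by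
  classical
  haveI := secondCountableTopology_su2
  haveI := borelSpace_config L
  set μ : Measure (GaugeConfig 3 L (Matrix.specialUnitaryGroup (Fin 2) ℂ)) := (wilsonMeasure (d := 3) (L := L) (fundamentalRep (Fin 2)) β') with hμ
  haveI : IsProbabilityMeasure μ :=
    isProbabilityMeasure_wilsonMeasure (d := 3) (L := L) (fundamentalRep (Fin 2)) (continuous_fundamentalRep (Fin 2)) β'
  set coords : GaugeConfig 3 L (Matrix.specialUnitaryGroup (Fin 2) ℂ) → (Edge 3 L × Fin 2 × Fin 2 × Bool → ℝ) :=
    fun V q => (fun z : ℂ => if q.2.2.2 then z.im else z.re) ((fundamentalRep (Fin 2) (V q.1) : Matrix (Fin 2) (Fin 2) ℂ) q.2.1 q.2.2.1) with hcoords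
  have hρ := continuous_fundamentalRep (Fin 2)
  have hco : Continuous coords := continuous_coords (L := L)
  have hSm := Literature.MathematicalPhysics.QuantumFieldTheory.measurable_wilsonAction (d := 3) (L := L) (G := Matrix.specialUnitaryGroup (Fin 2) ℂ) (fundamentalRep (Fin 2)) hρ
  obtain ⟨B, hB⟩ := Literature.MathematicalPhysics.QuantumFieldTheory.exists_abs_wilsonAction_le (d := 3) (L := L) (fundamentalRep (Fin 2)) hρ
  have hSi : Integrable (Literature.MathematicalPhysics.QuantumFieldTheory.wilsonAction (fundamentalRep (Fin 2))) μ :=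
    Integrable.of_bound hSm.aestronglyMeasurable B (ae_of_all _ fun U => by rw [Real.norm_eq_abs]; exact hB U)
  have hSSi : Integrable (fun x => Literature.MathematicalPhysics.QuantumFieldTheory.wilsonAction (fundamentalRep (Fin 2)) x * Literature.MathematicalPhysics.QuantumFieldTheory.wilsonAction (fundamentalRep (Fin 2)) x) μ :=
    Integrable.of_bound (hSm.mul hSm).aestronglyMeasurable (B * B) (ae_of_all _ fun U => by
      rw [Real.norm_eq_abs, abs_mul]; exact mul_le_mul (hB U) (hB U) (abs_nonneg _) ((abs_nonneg _).trans (hB U)))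
  set m : ℝ := ∫ z, Literature.MathematicalPhysics.QuantumFieldTheory.wilsonAction (fundamentalRep (Fin 2)) z ∂μ with hm
  -- `Var = ∫ S·S − m·m`
  have hvar : ∫ x, (Literature.MathematicalPhysics.QuantumFieldTheory.wilsonAction (fundamentalRep (Fin 2)) x - m) ^ 2 ∂μ = (∫ x, Literature.MathematicalPhysics.QuantumFieldTheory.wilsonAction (fundamentalRep (Fin 2)) x * Literature.MathematicalPhysics.QuantumFieldTheory.wilsonAction (fundamentalRep (Fin 2)) x ∂μ) - m * m := by
    have e : ∀ x : GaugeConfig 3 L (Matrix.specialUnitaryGroup (Fin 2) ℂ), (Literature.MathematicalPhysics.QuantumFieldTheory.wilsonAction (fundamentalRep (Fin 2)) x - m) ^ 2 = Literature.MathematicalPhysics.QuantumFieldTheory.wilsonAction (fundamentalRep (Fin 2)) x * Literature.MathematicalPhysics.QuantumFieldTheory.wilsonAction (fundamentalRep (Fin 2)) x - 2 * m * Literature.MathematicalPhysics.QuantumFieldTheory.wilsonAction (fundamentalRep (Fin 2)) x + m ^ 2 :=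
      fun x => by ring
    have i2 : Integrable (fun x => 2 * m * Literature.MathematicalPhysics.QuantumFieldTheory.wilsonAction (fundamentalRep (Fin 2)) x) μ := hSi.const_mul (2 * m)
    have i1 : Integrable (fun x => Literature.MathematicalPhysics.QuantumFieldTheory.wilsonAction (fundamentalRep (Fin 2)) x * Literature.MathematicalPhysics.QuantumFieldTheory.wilsonAction (fundamentalRep (Fin 2)) x - 2 * m * Literature.MathematicalPhysics.QuantumFieldTheory.wilsonAction (fundamentalRep (Fin 2)) x) μ := hSSi.sub i2
    rw [integral_congr_ae (ae_of_all _ e), integral_add i1 (integrable_const (m ^ 2)), integral_sub hSSi i2,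
      MeasureTheory.integral_const_mul, MeasureTheory.integral_const, smul_eq_mul, probReal_univ, one_mul, ← hm]
    ring
  rw [hvar]
  -- expand the first factor through words
  have hPc : ∀ p : Plaquette 3 L, Continuous fun x => (fun y : (Edge 3 L × Fin 2 × Fin 2 × Bool → ℝ) => (([((p.1, p.2.1.1), false), ((Literature.MathematicalPhysics.QuantumFieldTheory.Site.shift p.1 p.2.1.1, p.2.1.2), false), ((Literature.MathematicalPhysics.QuantumFieldTheory.Site.shift p.1 p.2.1.2, p.2.1.1), true), ((p.1, p.2.1.2), true)].map (fun a : Edge 3 L × Bool => if a.2 then ((fun (ee : Edge 3 L) => Matrix.of fun (i j : Fin 2) => ((y (ee, i, j, false) : ℝ) : ℂ) + ((y (ee, i, j, true) : ℝ) : ℂ) * Complex.I) a.1)ᴴ else (fun (ee : Edge 3 L) => Matrix.of fun (i j : Fin 2) => ((y (ee, i, j, false) : ℝ) : ℂ) + ((y (ee, i, j, true) : ℝ) : ℂ) * Complex.I) a.1)).prod).trace.re) (coords x) := fun p =>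
    (contDiff_word (L := L) [((p.1, p.2.1.1), false), ((Literature.MathematicalPhysics.QuantumFieldTheory.Site.shift p.1 p.2.1.1, p.2.1.2), false), ((Literature.MathematicalPhysics.QuantumFieldTheory.Site.shift p.1 p.2.1.2, p.2.1.1), true), ((p.1, p.2.1.2), true)] (m := 1)).continuous.comp hco
  have hS : ∀ x : GaugeConfig 3 L (Matrix.specialUnitaryGroup (Fin 2) ℂ), Literature.MathematicalPhysics.QuantumFieldTheory.wilsonAction (fundamentalRep (Fin 2)) x = ∑ p : Plaquette 3 L, (2 - (fun y : (Edge 3 L × Fin 2 × Fin 2 × Bool → ℝ) => (([((p.1, p.2.1.1), false), ((Literature.MathematicalPhysics.QuantumFieldTheory.Site.shift p.1 p.2.1.1, p.2.1.2), false), ((Literature.MathematicalPhysics.QuantumFieldTheory.Site.shift p.1 p.2.1.2, p.2.1.1), true), ((p.1, p.2.1.2), true)].map (fun a : Edge 3 L × Bool => if a.2 then ((fun (ee : Edge 3 L) => Matrix.of fun (i j : Fin 2) => ((y (ee, i, j, false) : ℝ) : ℂ) + ((y (ee, i, j, true) : ℝ) : ℂ) * Complex.I) a.1)ᴴ else (fun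 (ee : Edge 3 L) => Matrix.of fun (i j : Fin 2) => ((y (ee, i, j, false) : ℝ) : ℂ) + ((y (ee, i, j, true) : ℝ) : ℂ) * Complex.I) a.1)).prod).trace.re) (coords x)) :=
    fun x => wilsonAction_eq_sum_word (L := L) x
  have hiP : ∀ p : Plaquette 3 L, Integrable (fun x => (fun y : (Edge 3 L × Fin 2 × Fin 2 × Bool → ℝ) => (([((p.1, p.2.1.1), false), ((Literature.MathematicalPhysics.QuantumFieldTheory.Site.shift p.1 p.2.1.1, p.2.1.2), false), ((Literature.MathematicalPhysics.QuantumFieldTheory.Site.shift p.1 p.2.1.2, p.2.1.1), true), ((p.1, p.2.1.2), true)].map (fun a : Edge 3 L × Bool => if a.2 then ((fun (ee : Edge 3 L) => Matrix.of fun (i j : Fin 2) => ((y (ee, i, j, false) : ℝ) : ℂ) + ((y (ee, i, j, true) : ℝ) : ℂ) * Complex.I) a.1)ᴴ else (fun (ee : Edge 3 L) => Matrix.of fun (i j : Fin 2) => ((y (ee, i, j, false) : ℝ) : ℂ) + ((y (ee, i, j, true) : ℝ) : ℂ) * Complex.I) a.1)).prod).trace.re) (coords x)) μ := fun p => integrable_of_continuous_of_compactSpace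 (hPc p) μ
  have hiPS : ∀ p : Plaquette 3 L, Integrable (fun x => (fun y : (Edge 3 L × Fin 2 × Fin 2 × Bool → ℝ) => (([((p.1, p.2.1.1), false), ((Literature.MathematicalPhysics.QuantumFieldTheory.Site.shift p.1 p.2.1.1, p.2.1.2), false), ((Literature.MathematicalPhysics.QuantumFieldTheory.Site.shift p.1 p.2.1.2, p.2.1.1), true), ((p.1, p.2.1.2), true)].map (fun a : Edge 3 L × Bool => if a.2 then ((fun (ee : Edge 3 L) => Matrix.of fun (i j : Fin 2) => ((y (ee, i, j, false) : ℝ) : ℂ) + ((y (ee, i, j, true) : ℝ) : ℂ) * Complex.I) a.1)ᴴ else (fun (ee : Edge 3 L) => Matrix.of fun (i j : Fin 2) => ((y (ee, i, j, false) : ℝ) : ℂ) + ((y (ee, i, j, true) : ℝ) : ℂ) * Complex.I) a.1)).prod).trace.re) (coords x) * Literature.MathematicalPhysics.QuantumFieldTheory.wilsonAction (fundamentalRep (Fin 2)) x) μ := by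
    intro p
    obtain ⟨MP, -, hMP⟩ := exists_abs_le_of_continuous (hPc p)
    refine Integrable.of_bound ((hPc p).measurable.mul hSm).aestronglyMeasurable (MP * B) (ae_of_all _ fun U => ?_)
    rw [Real.norm_eq_abs, abs_mul]
    exact mul_le_mul (hMP U) (hB U) (abs_nonneg _) ((abs_nonneg _).trans (hMP U))
  have e1 : ∫ x, Literature.MathematicalPhysics.QuantumFieldTheory.wilsonAction (fundamentalRep (Fin 2)) x * Literature.MathematicalPhysics.QuantumFieldTheory.wilsonAction (fundamentalRep (Fin 2)) x ∂μ = ∑ p : Plaquette 3 L, (2 * m - ∫ x, (fun y : (Edge 3 L × Fin 2 × Fin 2 × Bool → ℝ) => (([((p.1, p.2.1.1), false), ((Literature.MathematicalPhysics.QuantumFieldTheory.Site.shift p.1 p.2.1.1, p.2.1.2), false), ((Literature.MathematicalPhysics.QuantumFieldTheory.Site.shift p.1 p.2.1.2, p.2.1.1), true), ((p.1, p.2.1.2), true)].map (fun a : Edge 3 L × Bool => if a.2 then ((fun (ee : Edge 3 L) => Matrix.of fun (i j : Fin 2) => ((y (ee, i, j, false) : ℝ) : ℂ) + ((y (ee,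 i, j, true) : ℝ) : ℂ) * Complex.I) a.1)ᴴ else (fun (ee : Edge 3 L) => Matrix.of fun (i j : Fin 2) => ((y (ee, i, j, false) : ℝ) : ℂ) + ((y (ee, i, j, true) : ℝ) : ℂ) * Complex.I) a.1)).prod).trace.re) (coords x) * Literature.MathematicalPhysics.QuantumFieldTheory.wilsonAction (fundamentalRep (Fin 2)) x ∂μ) := by
    have hWS : ∀ x : GaugeConfig 3 L (Matrix.specialUnitaryGroup (Fin 2) ℂ), Literature.MathematicalPhysics.QuantumFieldTheory.wilsonAction (fundamentalRep (Fin 2)) x * Literature.MathematicalPhysics.QuantumFieldTheory.wilsonAction (fundamentalRep (Fin 2)) x =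
        ∑ p : Plaquette 3 L, (2 * Literature.MathematicalPhysics.QuantumFieldTheory.wilsonAction (fundamentalRep (Fin 2)) x - (fun y : (Edge 3 L × Fin 2 × Fin 2 × Bool → ℝ) => (([((p.1, p.2.1.1), false), ((Literature.MathematicalPhysics.QuantumFieldTheory.Site.shift p.1 p.2.1.1, p.2.1.2), false), ((Literature.MathematicalPhysics.QuantumFieldTheory.Site.shift p.1 p.2.1.2, p.2.1.1), true), ((p.1, p.2.1.2), true)].map (fun a : Edge 3 L × Bool => if a.2 then ((fun (ee : Edge 3 L) => Matrix.of fun (i j : Fin 2) => ((y (ee, i, j, false) : ℝ) : ℂ) + ((y (ee, i, j, true) : ℝ) : ℂ) * Complex.I) a.1)ᴴ else (fun (ee : Edge 3 L) => Matrix.of fun (i j : Fin 2) => ((y (ee, i, j, false) : ℝ) : ℂ) + ((y (ee, i, j, true) : ℝ) : ℂ) * Complex.I) a.1)).prod).trace.re) (coords x) * Literature.MathematicalPhysics.QuantumFieldTheory.wilsonAction (fundamentalRep (Fin 2)) x) := fun x => by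
      calc Literature.MathematicalPhysics.QuantumFieldTheory.wilsonAction (fundamentalRep (Fin 2)) x * Literature.MathematicalPhysics.QuantumFieldTheory.wilsonAction (fundamentalRep (Fin 2)) x = (∑ p : Plaquette 3 L, (2 - (fun y : (Edge 3 L × Fin 2 × Fin 2 × Bool → ℝ) => (([((p.1, p.2.1.1), false), ((Literature.MathematicalPhysics.QuantumFieldTheory.Site.shift p.1 p.2.1.1, p.2.1.2), false), ((Literature.MathematicalPhysics.QuantumFieldTheory.Site.shift p.1 p.2.1.2, p.2.1.1), true), ((p.1, p.2.1.2), true)].map (fun a : Edge 3 L × Bool => if a.2 then ((fun (ee : Edge 3 L) => Matrix.of fun (i j : Fin 2) => ((y (ee, i, j, false) : ℝ) : ℂ) + ((y (ee, i, j, true) : ℝ) : ℂ) * Complex.I) a.1)ᴴ else (fun (ee : Edge 3 L) => Matrix.of fun (i j : Fin 2) => ((y (ee, i, j, false) : ℝ) : ℂ) + ((y (ee, i, j, true) : ℝ) : ℂ) * Complex.I) a.1)).prod).trace.re) (coords x))) * Literature.MathematicalPhysics.QuantumFieldTheory.wilsonAction (fundamentalRep (Fin 2)) x := by rw [← hS 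x]
        _ = ∑ p : Plaquette 3 L, (2 - (fun y : (Edge 3 L × Fin 2 × Fin 2 × Bool → ℝ) => (([((p.1, p.2.1.1), false), ((Literature.MathematicalPhysics.QuantumFieldTheory.Site.shift p.1 p.2.1.1, p.2.1.2), false), ((Literature.MathematicalPhysics.QuantumFieldTheory.Site.shift p.1 p.2.1.2, p.2.1.1), true), ((p.1, p.2.1.2), true)].map (fun a : Edge 3 L × Bool => if a.2 then ((fun (ee : Edge 3 L) => Matrix.of fun (i j : Fin 2) => ((y (ee, i, j, false) : ℝ) : ℂ) + ((y (ee, i, j, true) : ℝ) : ℂ) * Complex.I) a.1)ᴴ else (fun (ee : Edge 3 L) => Matrix.of fun (i j : Fin 2) => ((y (ee, i, j, false) : ℝ) : ℂ) + ((y (ee, i, j, true) : ℝ) : ℂ) * Complex.I) a.1)).prod).trace.re) (coords x)) * Literature.MathematicalPhysics.QuantumFieldTheory.wilsonAction (fundamentalRep (Fin 2)) x := Finset.sum_mul _ _ _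
        _ = _ := Finset.sum_congr rfl fun p _ => by ring
    rw [integral_congr_ae (ae_of_all _ hWS),
      integral_finsetSum (s := Finset.univ)
        (f := fun (p : Plaquette 3 L) (x : GaugeConfig 3 L (Matrix.specialUnitaryGroup (Fin 2) ℂ)) => 2 * Literature.MathematicalPhysics.QuantumFieldTheory.wilsonAction (fundamentalRep (Fin 2)) x - (fun y : (Edge 3 L × Fin 2 × Fin 2 × Bool → ℝ) => (([((p.1, p.2.1.1), false), ((Literature.MathematicalPhysics.QuantumFieldTheory.Site.shift p.1 p.2.1.1, p.2.1.2), false), ((Literature.MathematicalPhysics.QuantumFieldTheory.Site.shift p.1 p.2.1.2, p.2.1.1), true), ((p.1, p.2.1.2), true)].map (fun a : Edge 3 L × Bool => if a.2 then ((fun (ee : Edge 3 L) => Matrix.of fun (i j : Fin 2) => ((y (ee, i, j, false) : ℝ) : ℂ) + ((y (ee, i, j, true) : ℝ) : ℂ) * Complex.I) a.1)ᴴ else (fun (ee : Edge 3 L) => Matrix.of fun (i j : Fin 2) => ((y (ee, i, j, false) : ℝ) : ℂ) + ((y (ee, i, j, true) : ℝ) : ℂ) * Complex.I) a.1)).prod).trace.re)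 (coords x) * Literature.MathematicalPhysics.QuantumFieldTheory.wilsonAction (fundamentalRep (Fin 2)) x)
        (fun p _ => (hSi.const_mul 2).sub (hiPS p))]
    refine Finset.sum_congr rfl fun p _ => ?_
    rw [integral_sub (hSi.const_mul 2) (hiPS p), MeasureTheory.integral_const_mul]
  have e2 : m = ∑ p : Plaquette 3 L, (2 - ∫ x, (fun y : (Edge 3 L × Fin 2 × Fin 2 × Bool → ℝ) => (([((p.1, p.2.1.1), false), ((Literature.MathematicalPhysics.QuantumFieldTheory.Site.shift p.1 p.2.1.1, p.2.1.2), false), ((Literature.MathematicalPhysics.QuantumFieldTheory.Site.shift p.1 p.2.1.2, p.2.1.1), true), ((p.1, p.2.1.2), true)].map (fun a : Edge 3 L × Bool => if a.2 then ((fun (ee : Edge 3 L) => Matrix.of fun (i j : Fin 2) => ((y (ee, i, j, false) : ℝ) : ℂ) + ((y (ee, i, j, true) : ℝ) : ℂ) * Complex.I) a.1)ᴴ else (fun (ee : Edge 3 L) => Matrix.of fun (i j : Fin 2) => ((y (ee, i, j, false) : ℝ) : ℂ) + ((y (ee, i, j, true) : ℝ) : ℂ) * Complex.I) a.1)).prod).trace.re)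 (coords x) ∂μ) := by
    rw [hm, integral_congr_ae (ae_of_all _ hS),
      integral_finsetSum (s := Finset.univ)
        (f := fun (p : Plaquette 3 L) (x : GaugeConfig 3 L (Matrix.specialUnitaryGroup (Fin 2) ℂ)) => 2 - (fun y : (Edge 3 L × Fin 2 × Fin 2 × Bool → ℝ) => (([((p.1, p.2.1.1), false), ((Literature.MathematicalPhysics.QuantumFieldTheory.Site.shift p.1 p.2.1.1, p.2.1.2), false), ((Literature.MathematicalPhysics.QuantumFieldTheory.Site.shift p.1 p.2.1.2, p.2.1.1), true), ((p.1, p.2.1.2), true)].map (fun a : Edge 3 L × Bool => if a.2 then ((fun (ee : Edge 3 L) => Matrix.of fun (i j : Fin 2) => ((y (ee, i, j, false) : ℝ) : ℂ) + ((y (ee, i, j, true) : ℝ) : ℂ) * Complex.I) a.1)ᴴ else (fun (ee : Edge 3 L) => Matrix.of fun (i j : Fin 2) => ((y (ee, i, j, false) : ℝ) : ℂ) + ((y (ee, i, j, true) : ℝ) : ℂ) * Complex.I) a.1)).prod).trace.re) (coords x))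
        (fun p _ => (integrable_const (2:ℝ)).sub (hiP p))]
    refine Finset.sum_congr rfl fun p _ => ?_
    rw [integral_sub (integrable_const _) (hiP p), MeasureTheory.integral_const, smul_eq_mul, probReal_univ, one_mul]
  have e3 : (∫ x, Literature.MathematicalPhysics.QuantumFieldTheory.wilsonAction (fundamentalRep (Fin 2)) x * Literature.MathematicalPhysics.QuantumFieldTheory.wilsonAction (fundamentalRep (Fin 2)) x ∂μ) - m * m =
      ∑ p : Plaquette 3 L, -((∫ x, (fun y : (Edge 3 L × Fin 2 × Fin 2 × Bool → ℝ) => (([((p.1, p.2.1.1), false), ((Literature.MathematicalPhysics.QuantumFieldTheory.Site.shift p.1 p.2.1.1, p.2.1.2), false), ((Literature.MathematicalPhysics.QuantumFieldTheory.Site.shift p.1 p.2.1.2, p.2.1.1), true), ((p.1, p.2.1.2), true)].map (fun a : Edge 3 L × Bool => if a.2 then ((fun (ee : Edge 3 L) => Matrix.of fun (i j : Fin 2) => ((y (ee, i, j, false) : ℝ) : ℂ) + ((y (ee, i, j, true) : ℝ) : ℂ) * Complex.I) a.1)ᴴ else (fun (ee : Edge 3 L) => Matrix.of fun (i j : Fin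 2) => ((y (ee, i, j, false) : ℝ) : ℂ) + ((y (ee, i, j, true) : ℝ) : ℂ) * Complex.I) a.1)).prod).trace.re) (coords x) * Literature.MathematicalPhysics.QuantumFieldTheory.wilsonAction (fundamentalRep (Fin 2)) x ∂μ) - (∫ x, (fun y : (Edge 3 L × Fin 2 × Fin 2 × Bool → ℝ) => (([((p.1, p.2.1.1), false), ((Literature.MathematicalPhysics.QuantumFieldTheory.Site.shift p.1 p.2.1.1, p.2.1.2), false), ((Literature.MathematicalPhysics.QuantumFieldTheory.Site.shift p.1 p.2.1.2, p.2.1.1), true), ((p.1, p.2.1.2), true)].map (fun a : Edge 3 L × Bool => if a.2 then ((fun (ee : Edge 3 L) => Matrix.of fun (i j : Fin 2) => ((y (ee, i, j, false) : ℝ) : ℂ) + ((y (ee, i, j, true) : ℝ) : ℂ) * Complex.I) a.1)ᴴ else (fun (ee : Edge 3 L) => Matrix.of fun (i j : Fin 2) => ((y (ee, i, j, false) : ℝ) : ℂ) + ((y (ee, i, j, true) : ℝ) : ℂ) * Complex.I) a.1)).prod).trace.re) (coords x) ∂μ) * m) := by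
    rw [e1]
    have hmm : m * m = m * ∑ p : Plaquette 3 L, (2 - ∫ x, (fun y : (Edge 3 L × Fin 2 × Fin 2 × Bool → ℝ) => (([((p.1, p.2.1.1), false), ((Literature.MathematicalPhysics.QuantumFieldTheory.Site.shift p.1 p.2.1.1, p.2.1.2), false), ((Literature.MathematicalPhysics.QuantumFieldTheory.Site.shift p.1 p.2.1.2, p.2.1.1), true), ((p.1, p.2.1.2), true)].map (fun a : Edge 3 L × Bool => if a.2 then ((fun (ee : Edge 3 L) => Matrix.of fun (i j : Fin 2) => ((y (ee, i, j, false) : ℝ) : ℂ) + ((y (ee, i, j, true) : ℝ) : ℂ) * Complex.I) a.1)ᴴ else (fun (ee : Edge 3 L) => Matrix.of fun (i j : Fin 2) => ((y (ee, i, j, false) : ℝ) : ℂ) + ((y (ee, i, j, true) : ℝ) : ℂ) * Complex.I) a.1)).prod).trace.re) (coords x) ∂μ) := by rw [← e2]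
    rw [hmm, Finset.mul_sum, ← Finset.sum_sub_distrib]
    refine Finset.sum_congr rfl fun p _ => ?_
    ring
  rw [e3]
  refine (le_abs_self _).trans ((Finset.abs_sum_le_sum_abs _ _).trans ?_)
  have hb : ∀ p : Plaquette 3 L, |-((∫ x, (fun y : (Edge 3 L × Fin 2 × Fin 2 × Bool → ℝ) => (([((p.1, p.2.1.1), false), ((Literature.MathematicalPhysics.QuantumFieldTheory.Site.shift p.1 p.2.1.1, p.2.1.2), false), ((Literature.MathematicalPhysics.QuantumFieldTheory.Site.shift p.1 p.2.1.2, p.2.1.1), true), ((p.1, p.2.1.2), true)].map (fun a : Edge 3 L × Bool => if a.2 then ((fun (ee : Edge 3 L) => Matrix.of fun (i j : Fin 2) => ((y (ee, i, j, false) : ℝ) : ℂ) + ((y (ee, i, j, true) : ℝ) : ℂ) * Complex.I) a.1)ᴴ else (fun (ee : Edge 3 L) => Matrix.of fun (i j : Fin 2) => ((y (ee, i, j, false) : ℝ) : ℂ) + ((y (ee, i, j, true) : ℝ) : ℂ) * Complex.I) a.1)).prod).trace.re) (coords x) * Literature.MathematicalPhysics.QuantumFieldTheory.wilsonAction (fundamentalRep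 (Fin 2)) x ∂μ) - (∫ x, (fun y : (Edge 3 L × Fin 2 × Fin 2 × Bool → ℝ) => (([((p.1, p.2.1.1), false), ((Literature.MathematicalPhysics.QuantumFieldTheory.Site.shift p.1 p.2.1.1, p.2.1.2), false), ((Literature.MathematicalPhysics.QuantumFieldTheory.Site.shift p.1 p.2.1.2, p.2.1.1), true), ((p.1, p.2.1.2), true)].map (fun a : Edge 3 L × Bool => if a.2 then ((fun (ee : Edge 3 L) => Matrix.of fun (i j : Fin 2) => ((y (ee, i, j, false) : ℝ) : ℂ) + ((y (ee, i, j, true) : ℝ) : ℂ) * Complex.I) a.1)ᴴ else (fun (ee : Edge 3 L) => Matrix.of fun (i j : Fin 2) => ((y (ee, i, j, false) : ℝ) : ℂ) + ((y (ee, i, j, true) : ℝ) : ℂ) * Complex.I) a.1)).prod).trace.re) (coords x) ∂μ) * m)| ≤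
      3 * (4 : ℝ) * ((1024 * Real.pi ^ 2 * (4 : ℝ) ^ 2 / (1 - 12 * |β'|)) * Real.exp ((1 - 12 * |β'|) * Real.log 108 / (2 * ((1300 + 4 * Real.sqrt 2) * |β'| + (1 - 12 * |β'|))))) * ((1 + 12 / ((1 - 12 * |β'|) * Real.log 108 / (2 * ((1300 + 4 * Real.sqrt 2) * |β'| + (1 - 12 * |β'|))))) ^ 3 / (1 - Real.exp (-(((1 - 12 * |β'|) * Real.log 108 / (2 * ((1300 + 4 * Real.sqrt 2) * |β'| + (1 - 12 * |β'|)))) / 2)))) := by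
    intro p
    rw [abs_neg]
    have h := wilson_loop_action_covariance_abs_le L β' hβ [((p.1, p.2.1.1), false), ((Literature.MathematicalPhysics.QuantumFieldTheory.Site.shift p.1 p.2.1.1, p.2.1.2), false), ((Literature.MathematicalPhysics.QuantumFieldTheory.Site.shift p.1 p.2.1.2, p.2.1.1), true), ((p.1, p.2.1.2), true)] (List.cons_ne_nil _ _)
    have hlen : (([((p.1, p.2.1.1), false), ((Literature.MathematicalPhysics.QuantumFieldTheory.Site.shift p.1 p.2.1.1, p.2.1.2), false), ((Literature.MathematicalPhysics.QuantumFieldTheory.Site.shift p.1 p.2.1.2, p.2.1.1), true), ((p.1, p.2.1.2), true)] : List (Edge 3 L × Bool)).length : ℝ) = 4 := by norm_num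
    rw [hlen] at h
    exact h
  calc ∑ p : Plaquette 3 L, |-((∫ x, (fun y : (Edge 3 L × Fin 2 × Fin 2 × Bool → ℝ) => (([((p.1, p.2.1.1), false), ((Literature.MathematicalPhysics.QuantumFieldTheory.Site.shift p.1 p.2.1.1, p.2.1.2), false), ((Literature.MathematicalPhysics.QuantumFieldTheory.Site.shift p.1 p.2.1.2, p.2.1.1), true), ((p.1, p.2.1.2), true)].map (fun a : Edge 3 L × Bool => if a.2 then ((fun (ee : Edge 3 L) => Matrix.of fun (i j : Fin 2) => ((y (ee, i, j, false) : ℝ) : ℂ) + ((y (ee, i, j, true) : ℝ) : ℂ) * Complex.I) a.1)ᴴ else (fun (ee : Edge 3 L) => Matrix.of fun (i j : Fin 2) => ((y (ee, i, j, false) : ℝ) : ℂ) + ((y (ee, i, j, true) : ℝ) : ℂ) * Complex.I) a.1)).prod).trace.re) (coords x) * Literature.MathematicalPhysics.QuantumFieldTheory.wilsonAction (fundamentalRep (Fin 2)) x ∂μ) - (∫ x, (fun y : (Edge 3 L × Fin 2 × Fin 2 × Bool → ℝ) => (([((p.1, p.2.1.1), false), ((Literature.MathematicalPhysics.QuantumFieldTheory.Site.shift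 p.1 p.2.1.1, p.2.1.2), false), ((Literature.MathematicalPhysics.QuantumFieldTheory.Site.shift p.1 p.2.1.2, p.2.1.1), true), ((p.1, p.2.1.2), true)].map (fun a : Edge 3 L × Bool => if a.2 then ((fun (ee : Edge 3 L) => Matrix.of fun (i j : Fin 2) => ((y (ee, i, j, false) : ℝ) : ℂ) + ((y (ee, i, j, true) : ℝ) : ℂ) * Complex.I) a.1)ᴴ else (fun (ee : Edge 3 L) => Matrix.of fun (i j : Fin 2) => ((y (ee, i, j, false) : ℝ) : ℂ) + ((y (ee, i, j, true) : ℝ) : ℂ) * Complex.I) a.1)).prod).trace.re) (coords x) ∂μ) * m)|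
      ≤ ∑ _p : Plaquette 3 L, 3 * (4 : ℝ) * ((1024 * Real.pi ^ 2 * (4 : ℝ) ^ 2 / (1 - 12 * |β'|)) * Real.exp ((1 - 12 * |β'|) * Real.log 108 / (2 * ((1300 + 4 * Real.sqrt 2) * |β'| + (1 - 12 * |β'|))))) * ((1 + 12 / ((1 - 12 * |β'|) * Real.log 108 / (2 * ((1300 + 4 * Real.sqrt 2) * |β'| + (1 - 12 * |β'|))))) ^ 3 / (1 - Real.exp (-(((1 - 12 * |β'|) * Real.log 108 / (2 * ((1300 + 4 * Real.sqrt 2) * |β'| + (1 - 12 * |β'|)))) / 2)))) := Finset.sum_le_sum fun p _ => hb p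
    _ = _ := by rw [Finset.sum_const, Finset.card_univ, nsmul_eq_mul]

end Summit.QuantumFields.YangMills.Theorems.ColdStartUniversality.LiebRobinson
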